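import Literature.NumberTheory.LFunctions.ZetaZeroHarmonicSumUnconditional
import Literature.Analysis.SpecialFunctions.KernelLog
import HarnessLib

/-!
# RH-FREE — The two-sided harmonic sum over zeta zeros `Σ_{0<γ≤T} 1/γ = log²(T/2π)/(4π) + 0.9321ϑ` (Saouter–Trudgian–Demichel 2015, Lemma 2.10) PROVED with no named fact; Brent–Platt–Trudgian 2022 Lemma 8 DISCHARGED; Johnston–Yang 2023, Lemma 2.5 («nothing here bears on the truth of RH»)

Topic `Literature/NumberTheory/LFunctions` (RH literature-typing tranche 1, L4 "explicit zero
statistics", gen 6). Label: **RH-FREE**. THEOREMS only (no definitions, no named facts). Nothing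
here bears on the truth of RH.

* **Saouter–Trudgian–Demichel 2015, Lemma 2.10** (Math. Comp. 84 (2015) 2433–2446, §2.4 p. 2435;
  held: `[corpus:paper:doi-10-1090-s0025-5718-2015-02930-5 p0003 (Lemma 2.10)]`): "If `T ≥ 2πe`,
  then `Σ_{0<γ≤T} 1/γ = (1/4π) log²(T/2π) + 0.9321ϑ`" (`|ϑ| ≤ 1`; the source proves it by Lehman's
  lemma (its Lemma 2.7) with `φ(t) = 1/t` from `T₁ = 2πe`). PROVED here as
  `SaouterTrudgianDemichel2015_lemma210` (two-sided `|Σ − log²(T/2π)/(4π)| ≤ 0.9321`) for every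
  `T ≥ 2πe`, from theorems of the tree only: Lehman's lemma in the form
  `abs_sum_inv_sub_le_of_count` (`ZetaZeroSumsLehmanExplicit.lean`) on `(8π, T]` with the
  fact-free count error `|N(t) − L(t)| ≤ 0.3083 log t + 3.253 ≤ 2.2 log t` (`t ≥ 2π`,
  `abs_count_sub_countMain_le_backlund_two`), and below `8π` the certificates `N(30) ≤ 3`
  (`zetaZeroCount_le_three`) and "no zeros with `0 < γ ≤ 14`"
  (`riemannZeta_ne_zero_of_im_pos_of_im_le_fourteen`): `Σ_{0<γ≤8π} 1/γ ≤ 3/14`. Numerics: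
  `log²4/(4π) + 2.2(2 log 8π + 1)/(8π) ≤ 0.153 + 0.684 < 0.9321` and `3/14 + 0.684 < 0.9321`
  (kernel enclosures of `log 30`, `log 6`, Mathlib's `log 2`). The one-sided halves are
  `log_sq_div_sub_le_sum_inv_ordinate` (lower, all `T ≥ 2π`) and `sum_inv_ordinate_le_log_sq_div_add`
  (upper, every `T`). In the tree's vocabulary the sum is over `zerosBetween 0 T` (zeros with
  `0 < Im ρ ≤ T`, with multiplicity `m(ρ) = riemannZetaZeroOrder ρ`).
* **Johnston–Yang 2023, Lemma 2.5** (J. Math. Anal. Appl. 527 (2023) 127460 = arXiv:2204.01980v2,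
  §2 `[corpus:paper:arxiv-2204.01980 p0005 (Lemma 2.5)]`): "If `T ≥ 4πe`, then
  `(1/4π) log²(T/2π) − 0.9321 ≤ Σ_{0<Im ρ≤T} 1/Im ρ ≤ (1/4π) log²(T/2π)`" (cited there from
  Saouter–Trudgian–Demichel and Brent–Platt–Trudgian). PROVED as `JohnstonYang2023_lemma25` modulo
  the named fact `BrentPlattTrudgian2022_lemma8` (the upper half; itself a consequence of
  `BrentPlattTrudgian2022_cor1`, `BrentPlattTrudgian2022_lemma8_of_cor1`), and FACT-FREE as
  `JohnstonYang2023_lemma25_unconditional` with the upper constant `1/(4π) + 1.1·10⁻⁵`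
  (`sum_inv_ordinate_le_unconditional`).

* **Brent–Platt–Trudgian 2022, Lemma 8 — DISCHARGED**: `BrentPlattTrudgian2022_lemma8_holds :
  BrentPlattTrudgian2022_lemma8` (`Σ_{0<γ≤T} m(ρ)/γ ≤ log²(T/2π)/(4π)` for all `T ≥ 4πe`), from the
  kernel check on `[4πe, 2516]` (`sum_inv_ordinate_le_of_le_heightT0`) and, above `2516`, the source's
  Lehman argument with the fact-free `A = 2.2` (margin `0.0025`); hence `JohnstonYang2023_lemma25_holds`.

Searched first: the tree held the upper bound (BPT Lemma 8, as fact and fact-free variants,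
`ZetaZeroHarmonicSumBound*.lean`, `ZetaZeroHarmonicSumUnconditional.lean`) and Lehman's lemma,
but no LOWER bound for `Σ_{0<γ≤T} 1/γ` (`lean search '0.9321|9321'`: none).

## References

* Y. Saouter, T. Trudgian, P. Demichel, Math. Comp. 84 (2015) 2433–2446, Lemma 2.10 (and Lemmas
  2.7–2.8, Lehman). [SaouterTrudgianDemichel2015]
* D. R. Johnston, A. Yang, J. Math. Anal. Appl. 527 (2023) 127460, Lemma 2.5. [JohnstonYang2023]
* R. P. Brent, D. J. Platt, T. S. Trudgian, J. Number Theory 238 (2022) 740–762, Lemmas 2 and 8.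
  [BrentPlattTrudgian2022]
* R. S. Lehman, Acta Arith. 11 (1966) 397–410, Lemma (the summation lemma). [Lehman1966]
-/

noncomputable section

open Complex Filter Set MeasureTheory
open scoped Real

namespace Literature.NumberTheory.LFunctions

open SchoenfeldBound Literature.Analysis.SpecialFunctions

/-! ## Kernel numerics -/

/-- `1.7917 ≤ log 6` and `log 30 ≤ 3.4013` (kernel enclosures). [folklore] -/
private theorem log_numerics :
    (1.7917 : ℝ) ≤ Real.log 6 ∧ Real.log 30 ≤ 3.4013 := by
  have h1 : KernelLog.logIv 6 = some (2166104284888561533852022, 2166104284889037139674708) := by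
    decide +kernel
  have h2 : KernelLog.logIv 30 = some (4111795332296814105287541, 4111795332297289711206943) := by
    decide +kernel
  have hA := (KernelLog.logIv_sound h1).1
  have hB := (KernelLog.logIv_sound h2).2
  simp only [Nat.cast_ofNat] at hA hB
  norm_num at hA hB ⊢
  constructor <;> linarith

/-- **`|N(t) − L(t)| ≤ 2.2 log t` for every `t ≥ 2π`** (`L(t) = (t/2π)log(t/2π) − t/2π + 7/8`): the
tree's fact-free `|N(t) − L(t)| ≤ 0.3083 log t + 3.253` (`t ≥ 2`) and `log t ≥ log 6 ≥ 1.79`. This is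
the `A log t` hypothesis of Lehman's lemma (Brent–Platt–Trudgian's form) with `A = 2.2`, no named fact.
[cite: BrentPlattTrudgian2022, Lemma 2] [cite: SaouterTrudgianDemichel2015, Lemma 2.7] -/
theorem abs_count_sub_countMain_le_mul_log {t : ℝ} (ht : 2 * π ≤ t) :
    |(zetaZeroCount t : ℝ) - countMain t| ≤ 2.2 * Real.log t := by
  have hπ : 3 < π := Real.pi_gt_three
  have h := abs_count_sub_countMain_le_backlund_two (by linarith : (2 : ℝ) ≤ t)
  unfold FKS2023.countErr at h
  have hlog : 1.7917 ≤ Real.log t :=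
    log_numerics.1.trans (Real.log_le_log (by norm_num) (by linarith))
  have : 0 * Real.log (Real.log t) = 0 := zero_mul _
  linarith

/-- **The first zeros**: `Σ_{0<γ≤T} m(ρ)/γ ≤ 3/14` for `T ≤ 30` — every zero has `γ > 14` and
`N(30) ≤ 3` (tree certificates). [cite: BrentPlattTrudgian2022, Lemma 8 (proof: "the first 80 zeros")] -/
theorem sum_inv_ordinate_le_of_le_thirty {T : ℝ} (hT : T ≤ 30) :
    ∑ ρ ∈ zerosBetween 0 T, (riemannZetaZeroOrder ρ : ℝ) * (1 / ρ.im) ≤ 3 / 14 := by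
  rcases le_or_gt T 0 with hT0 | hT0
  · have hempty : zerosBetween 0 T = ∅ := by
      ext ρ
      simp only [Finset.notMem_empty, iff_false]
      intro hρ
      obtain ⟨-, -, -, h3, h4⟩ := (mem_zerosBetween le_rfl).1 hρ
      linarith
    rw [hempty, Finset.sum_empty]; norm_num
  have h := SoundTest.sum_zerosBetween_le_count le_rfl hT0.le (w := fun γ : ℝ ↦ 1 / γ) (W := 1 / 14)
    (fun ρ hρ ↦ by
      obtain ⟨hz, -, -, h3, -⟩ := (mem_zerosBetween le_rfl).1 hρ
      have h14 : 14 < ρ.im := by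
        by_contra hle
        exact riemannZeta_ne_zero_of_im_pos_of_im_le_fourteen h3 (not_lt.1 hle) hz
      show 1 / ρ.im ≤ 1 / 14
      exact one_div_le_one_div_of_le (by norm_num) h14.le)
  have h3 := zetaZeroCount_le_three hT
  rw [zetaZeroCount_eq_zero_of_nonpos le_rfl, Nat.cast_zero, sub_zero] at h
  refine h.trans ?_
  nlinarith

/-! ## The lower half (new in the tree) -/

/-- **Lower bound, all `T ≥ 2π`: `log²(T/2π)/(4π) − 0.9321 ≤ Σ_{0<γ≤T} m(ρ)/γ`.** Lehman on
`(8π, T]` with `A = 2.2` (`log(8π/2π) = 2 log 2`, `log 8π ≤ log 30`), the zeros below `8π` dropped;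
below `8π` the left side is negative. [cite: SaouterTrudgianDemichel2015, Lemma 2.10] -/
theorem log_sq_div_sub_le_sum_inv_ordinate {T : ℝ} (hT : 2 * π ≤ T) :
    Real.log (T / (2 * π)) ^ 2 / (4 * π) - 0.9321 ≤
      ∑ ρ ∈ zerosBetween 0 T, (riemannZetaZeroOrder ρ : ℝ) * (1 / ρ.im) := by
  have hπ3 : 3.141592 < π := Real.pi_gt_d6
  have hπ4 : π < 3.141593 := Real.pi_lt_d6
  have hπ0 : 0 < π := Real.pi_pos
  have hl2 : Real.log 2 < 0.6931471808 := Real.log_two_lt_d9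
  have hl2' : 0.6931471803 < Real.log 2 := Real.log_two_gt_d9
  obtain ⟨-, h30⟩ := log_numerics
  have hlog4 : Real.log (8 * π / (2 * π)) = 2 * Real.log 2 := by
    rw [show 8 * π / (2 * π) = 2 ^ 2 by field_simp; ring, Real.log_pow]; norm_num
  have hnonneg : ∀ U : ℝ, 0 ≤ ∑ ρ ∈ zerosBetween 0 U, (riemannZetaZeroOrder ρ : ℝ) * (1 / ρ.im) :=
    fun U ↦ Finset.sum_nonneg fun ρ hρ ↦ by
      have hm := zeroOrder_nonneg_of_mem_zerosBetween le_rfl hρ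
      obtain ⟨-, -, -, h3, -⟩ := (mem_zerosBetween le_rfl).1 hρ
      exact mul_nonneg hm (by positivity)
  rcases le_or_gt T (8 * π) with h8 | h8
  · -- below 8π: the main term is at most log²4/(4π) < 0.9321
    have hlo : 0 ≤ Real.log (T / (2 * π)) :=
      Real.log_nonneg ((one_le_div (by positivity)).2 hT)
    have hhi : Real.log (T / (2 * π)) ≤ 2 * Real.log 2 := by
      rw [← hlog4]
      exact Real.log_le_log (div_pos (by linarith) (by positivity))
        (div_le_div_of_nonneg_right h8 (by positivity))
    have hsq : Real.log (T / (2 * π)) ^ 2 ≤ (2 * Real.log 2) ^ 2 := pow_le_pow_left₀ hlo hhi 2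
    have hmain : Real.log (T / (2 * π)) ^ 2 / (4 * π) ≤ 0.9321 := by
      rw [div_le_iff₀ (by positivity)]
      nlinarith
    linarith [hnonneg T]
  · -- Lehman on (8π, T]
    have h2π8 : 2 * π ≤ 8 * π := by linarith
    have hL := abs_sum_inv_sub_le_of_count (fun t ht ↦ abs_count_sub_countMain_le_mul_log ht)
      h2π8 h8.le
    rw [hlog4] at hL
    have hsplit := SoundTest.sum_zerosBetween_split le_rfl (by positivity : (0 : ℝ) ≤ 8 * π) h8.le
      (fun ρ ↦ (riemannZetaZeroOrder ρ : ℝ) * (1 / ρ.im))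
    have hlow := hnonneg (8 * π)
    -- numerics: (2 log 2)²/(4π) + 2.2 (2 log 8π + 1)/(8π) ≤ 0.9321
    have hlog8π : Real.log (8 * π) ≤ 3.4013 :=
      (Real.log_le_log (by positivity) (by linarith)).trans h30
    have herr : 2.2 * (2 * Real.log (8 * π) + 1) / (8 * π) ≤ 0.684 := by
      rw [div_le_iff₀ (by positivity)]
      nlinarith
    have hmain : (2 * Real.log 2) ^ 2 / (4 * π) ≤ 0.153 := by
      rw [div_le_iff₀ (by positivity)]
      nlinarith
    have hL' := (abs_le.1 hL).1
    rw [hsplit]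
    have e : Real.log (T / (2 * π)) ^ 2 / (4 * π) =
        (Real.log (T / (2 * π)) ^ 2 - (2 * Real.log 2) ^ 2) / (4 * π) + (2 * Real.log 2) ^ 2 / (4 * π) := by
      field_simp; ring
    rw [e]
    linarith

/-! ## The upper half with the printed constant -/

/-- **Upper bound, every real `T`: `Σ_{0<γ≤T} m(ρ)/γ ≤ log²(T/2π)/(4π) + 0.9321`.** Lehman on
`(8π, T]` with `A = 2.2` and `Σ_{0<γ≤8π} ≤ 3/14` (below `8π` the sum is at most `3/14`). (The tree
also holds the sharper fact-free `sum_inv_ordinate_le_unconditional` for `T ≥ 4πe`.)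
[cite: SaouterTrudgianDemichel2015, Lemma 2.10] -/
theorem sum_inv_ordinate_le_log_sq_div_add (T : ℝ) :
    ∑ ρ ∈ zerosBetween 0 T, (riemannZetaZeroOrder ρ : ℝ) * (1 / ρ.im) ≤
      Real.log (T / (2 * π)) ^ 2 / (4 * π) + 0.9321 := by
  have hπ3 : 3.141592 < π := Real.pi_gt_d6
  have hπ4 : π < 3.141593 := Real.pi_lt_d6
  have hπ0 : 0 < π := Real.pi_pos
  have hl2 : Real.log 2 < 0.6931471808 := Real.log_two_lt_d9
  have hl2' : 0.6931471803 < Real.log 2 := Real.log_two_gt_d9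
  obtain ⟨-, h30⟩ := log_numerics
  have hsq0 : 0 ≤ Real.log (T / (2 * π)) ^ 2 / (4 * π) := by positivity
  rcases le_or_gt T (8 * π) with h8 | h8
  · have h := sum_inv_ordinate_le_of_le_thirty (by linarith : T ≤ 30)
    linarith
  · have h2π8 : 2 * π ≤ 8 * π := by linarith
    have hlog4 : Real.log (8 * π / (2 * π)) = 2 * Real.log 2 := by
      rw [show 8 * π / (2 * π) = 2 ^ 2 by field_simp; ring, Real.log_pow]; norm_num
    have hL := abs_sum_inv_sub_le_of_count (fun t ht ↦ abs_count_sub_countMain_le_mul_log ht)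
      h2π8 h8.le
    rw [hlog4] at hL
    have hsplit := SoundTest.sum_zerosBetween_split le_rfl (by positivity : (0 : ℝ) ≤ 8 * π) h8.le
      (fun ρ ↦ (riemannZetaZeroOrder ρ : ℝ) * (1 / ρ.im))
    have hlow := sum_inv_ordinate_le_of_le_thirty (by linarith : 8 * π ≤ 30)
    have hlog8π : Real.log (8 * π) ≤ 3.4013 :=
      (Real.log_le_log (by positivity) (by linarith)).trans h30
    have herr : 2.2 * (2 * Real.log (8 * π) + 1) / (8 * π) ≤ 0.684 := by
      rw [div_le_iff₀ (by positivity)]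
      nlinarith
    have hmain : 0 ≤ (2 * Real.log 2) ^ 2 / (4 * π) := by positivity
    have hL' := (abs_le.1 hL).2
    rw [hsplit]
    have e : Real.log (T / (2 * π)) ^ 2 / (4 * π) =
        (Real.log (T / (2 * π)) ^ 2 - (2 * Real.log 2) ^ 2) / (4 * π) + (2 * Real.log 2) ^ 2 / (4 * π) := by
      field_simp; ring
    rw [e]
    linarith

/-! ## Saouter–Trudgian–Demichel 2015, Lemma 2.10 -/

/-- **Saouter–Trudgian–Demichel 2015, Lemma 2.10** (PROVED, no named fact): "If `T ≥ 2πe`, then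
`Σ_{0<γ≤T} 1/γ = (1/4π) log²(T/2π) + 0.9321ϑ`" (`|ϑ| ≤ 1`), i.e.
`|Σ_{0<γ≤T} m(ρ)/γ − log²(T/2π)/(4π)| ≤ 0.9321`, ordinates with multiplicity.
[cite: SaouterTrudgianDemichel2015, Lemma 2.10] -/
theorem SaouterTrudgianDemichel2015_lemma210 {T : ℝ} (hT : 2 * π * Real.exp 1 ≤ T) :
    |∑ ρ ∈ zerosBetween 0 T, (riemannZetaZeroOrder ρ : ℝ) * (1 / ρ.im)
        - Real.log (T / (2 * π)) ^ 2 / (4 * π)| ≤ 0.9321 := by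
  have hπ0 : 0 < π := Real.pi_pos
  have he : 1 ≤ Real.exp 1 := Real.one_le_exp (by norm_num)
  have hT' : 2 * π ≤ T := le_trans (by nlinarith) hT
  rw [abs_le]
  constructor
  · linarith [log_sq_div_sub_le_sum_inv_ordinate hT']
  · linarith [sum_inv_ordinate_le_log_sq_div_add T]

/-- The same in the `m(ρ)/γ` spelling. [cite: SaouterTrudgianDemichel2015, Lemma 2.10] -/
theorem SaouterTrudgianDemichel2015_lemma210' {T : ℝ} (hT : 2 * π * Real.exp 1 ≤ T) :
    |∑ ρ ∈ zerosBetween 0 T, (riemannZetaZeroOrder ρ : ℝ) / ρ.im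
        - Real.log (T / (2 * π)) ^ 2 / (4 * π)| ≤ 0.9321 := by
  have e : ∑ ρ ∈ zerosBetween 0 T, (riemannZetaZeroOrder ρ : ℝ) / ρ.im =
      ∑ ρ ∈ zerosBetween 0 T, (riemannZetaZeroOrder ρ : ℝ) * (1 / ρ.im) :=
    Finset.sum_congr rfl fun ρ _ ↦ by ring
  rw [e]; exact SaouterTrudgianDemichel2015_lemma210 hT

/-! ## Johnston–Yang 2023, Lemma 2.5 -/

/-- **Johnston–Yang 2023, Lemma 2.5** (PROVED modulo the named fact `BrentPlattTrudgian2022_lemma8`,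
the upper half): "If `T ≥ 4πe`, then
`(1/4π) log²(T/2π) − 0.9321 ≤ Σ_{0<Im ρ≤T} 1/Im ρ ≤ (1/4π) log²(T/2π)`" (the lower half is
Saouter–Trudgian–Demichel's Lemma 2.10, a theorem of the tree: `log_sq_div_sub_le_sum_inv_ordinate`).
[cite: JohnstonYang2023, Lemma 2.5] [cite: SaouterTrudgianDemichel2015, Lemma 2.10]
[cite: BrentPlattTrudgian2022, Lemma 8] -/
theorem JohnstonYang2023_lemma25 (h8 : BrentPlattTrudgian2022_lemma8) {T : ℝ}
    (hT : 4 * π * Real.exp 1 ≤ T) :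
    Real.log (T / (2 * π)) ^ 2 / (4 * π) - 0.9321 ≤
        ∑ ρ ∈ zerosBetween 0 T, (riemannZetaZeroOrder ρ : ℝ) / ρ.im ∧
      ∑ ρ ∈ zerosBetween 0 T, (riemannZetaZeroOrder ρ : ℝ) / ρ.im ≤
        Real.log (T / (2 * π)) ^ 2 / (4 * π) := by
  have hπ0 : 0 < π := Real.pi_pos
  have he : 1 ≤ Real.exp 1 := Real.one_le_exp (by norm_num)
  have hT' : 2 * π ≤ T := le_trans (by nlinarith) hT
  have e : ∑ ρ ∈ zerosBetween 0 T, (riemannZetaZeroOrder ρ : ℝ) / ρ.im =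
      ∑ ρ ∈ zerosBetween 0 T, (riemannZetaZeroOrder ρ : ℝ) * (1 / ρ.im) :=
    Finset.sum_congr rfl fun ρ _ ↦ by ring
  refine ⟨?_, h8 T hT⟩
  rw [e]; exact log_sq_div_sub_le_sum_inv_ordinate hT'

/-- **Johnston–Yang's Lemma 2.5 with NO named fact**, at the price `1/(4π) ↦ 1/(4π) + 1.1·10⁻⁵` in
the upper half (the tree's `sum_inv_ordinate_le_unconditional`): for `T ≥ 4πe`,
`log²(T/2π)/(4π) − 0.9321 ≤ Σ_{0<γ≤T} m(ρ)/γ ≤ (1/(4π) + 1.1·10⁻⁵) log²(T/2π)`.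
[cite: JohnstonYang2023, Lemma 2.5] [cite: SaouterTrudgianDemichel2015, Lemma 2.10] -/
theorem JohnstonYang2023_lemma25_unconditional {T : ℝ} (hT : 4 * π * Real.exp 1 ≤ T) :
    Real.log (T / (2 * π)) ^ 2 / (4 * π) - 0.9321 ≤
        ∑ ρ ∈ zerosBetween 0 T, (riemannZetaZeroOrder ρ : ℝ) * (1 / ρ.im) ∧
      ∑ ρ ∈ zerosBetween 0 T, (riemannZetaZeroOrder ρ : ℝ) * (1 / ρ.im) ≤
        (1 / (4 * π) + 1.1e-5) * Real.log (T / (2 * π)) ^ 2 := by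
  have hπ0 : 0 < π := Real.pi_pos
  have he : 1 ≤ Real.exp 1 := Real.one_le_exp (by norm_num)
  have hT' : 2 * π ≤ T := le_trans (by nlinarith) hT
  exact ⟨log_sq_div_sub_le_sum_inv_ordinate hT', sum_inv_ordinate_le_unconditional hT⟩

/-! ## Brent–Platt–Trudgian 2022, Lemma 8 — DISCHARGED (no named fact) -/

/-- `5.9925 ≤ log(2516/2π)` and `log 2516 ≤ 7.8305` (kernel enclosures of `log 2516`, `log 6283186`,
`log 10⁶`; `2π ≤ 6.283186`). [folklore] -/
private theorem log_numerics_2516 :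
    (5.9925 : ℝ) ≤ Real.log (2516 / (2 * π)) ∧ Real.log 2516 ≤ 7.8305 := by
  have h1 : KernelLog.logIv 2516 = some (9466403707954595054280060, 9466403707955070660489610) := by
    decide +kernel
  have h2 : KernelLog.logIv 6283186 =
      some (18923784596844290756813982, 18923784596844766363603828) := by
    decide +kernel
  have h3 : KernelLog.logIv 1000000 =
      some (16701927424681285093179771, 16701927424681760699824543) := by
    decide +kernel
  have hA := KernelLog.logIv_sound h1
  have hB := (KernelLog.logIv_sound h2).2
  have hC := (KernelLog.logIv_sound h3).1
  simp only [Nat.cast_ofNat] at hA hB hC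
  have hπ4 : π < 3.141593 := Real.pi_lt_d6
  have hπ0 : 0 < π := Real.pi_pos
  have h2π : Real.log (2 * π) ≤ Real.log (6283186 : ℝ) - Real.log 1000000 := by
    rw [← Real.log_div (by norm_num) (by norm_num)]
    exact Real.log_le_log (by positivity) (by norm_num; linarith)
  have hsplit : Real.log (2516 / (2 * π)) = Real.log 2516 - Real.log (2 * π) :=
    Real.log_div (by norm_num) (by positivity)
  norm_num at hA hB hC ⊢
  constructor
  · rw [hsplit]; linarith [hA.1]
  · linarith [hA.2]

/-- **Brent–Platt–Trudgian 2022, Lemma 8 — DISCHARGE of the named fact `BrentPlattTrudgian2022_lemma8`**: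
for every `T ≥ 4πe`, `Σ_{0<γ≤T} m(ρ)/γ ≤ log²(T/2π)/(4π)`, now a theorem of the tree outright.
On `[4πe, 2516]`: the kernel step-function check against the certified first `2000` zeros
(`sum_inv_ordinate_le_of_le_heightT0`, `ZetaZeroHarmonicSumBoundLow.lean`). On `[2516, ∞)`: the
source's own argument (Lehman's lemma from `T₁`, with `ε(T₁) < 0`) at `T₁ = 2516` with the fact-free
`A = 2.2` of `abs_count_sub_countMain_le_mul_log` in place of Corollary 1's `0.28`:
`Σ_{0<γ≤2516} m/γ ≤ 2.8405` (`sum_inv_ordinate_low_le`), `|Σ_{2516<γ≤T} m/γ − (log²(T/2π) −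
log²(2516/2π))/(4π)| ≤ 2.2(2 log 2516 + 1)/2516 ≤ 0.01457`, and
`2.8405 − log²(2516/2π)/(4π) + 0.01457 ≤ 2.8405 − 2.8576 + 0.01457 < 0`. Users holding
`(h : BrentPlattTrudgian2022_lemma8)` can now be fed `BrentPlattTrudgian2022_lemma8_holds`.
[cite: BrentPlattTrudgian2022, Lemma 8] -/
theorem BrentPlattTrudgian2022_lemma8_holds : BrentPlattTrudgian2022_lemma8 := by
  intro T hT
  rcases le_or_gt T 2516 with hle | hgt
  · have hH : ((ZetaNumerics.Mertens.heightT0 : ℕ) : ℝ) = 2516 := by norm_num [ZetaNumerics.Mertens.heightT0]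
    exact sum_inv_ordinate_le_of_le_heightT0 hT (by rw [hH]; exact hle)
  · have hπ3 : 3.141592 < π := Real.pi_gt_d6
    have hπ4 : π < 3.141593 := Real.pi_lt_d6
    have h4π : (0 : ℝ) < 4 * π := by positivity
    have hH : ((ZetaNumerics.Mertens.heightT0 : ℕ) : ℝ) = 2516 := by norm_num [ZetaNumerics.Mertens.heightT0]
    have h2π2516 : 2 * π ≤ (2516 : ℝ) := by linarith
    have e : ∑ ρ ∈ zerosBetween 0 T, (riemannZetaZeroOrder ρ : ℝ) / ρ.im =
        ∑ ρ ∈ zerosBetween 0 T, (riemannZetaZeroOrder ρ : ℝ) * (1 / ρ.im) :=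
      Finset.sum_congr rfl fun ρ _ ↦ by ring
    rw [e, SoundTest.sum_zerosBetween_split le_rfl (by norm_num : (0 : ℝ) ≤ 2516) hgt.le]
    have hlow := sum_inv_ordinate_low_le
    rw [hH] at hlow
    have hup := (abs_le.1 (abs_sum_inv_sub_le_of_count
      (fun t ht ↦ abs_count_sub_countMain_le_mul_log ht) h2π2516 hgt.le)).2
    obtain ⟨hl1, hl2⟩ := log_numerics_2516
    -- numerics
    have hA : (2.8576 : ℝ) ≤ Real.log (2516 / (2 * π)) ^ 2 / (4 * π) := by
      rw [le_div_iff₀ h4π]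
      have hsq : (5.9925 : ℝ) ^ 2 ≤ Real.log (2516 / (2 * π)) ^ 2 := by
        have : (0 : ℝ) ≤ 5.9925 := by norm_num
        nlinarith
      nlinarith
    have hB : 2.2 * (2 * Real.log 2516 + 1) / 2516 ≤ 0.01457 := by
      rw [div_le_iff₀ (by norm_num)]
      nlinarith
    have hsd : (Real.log (T / (2 * π)) ^ 2 - Real.log (2516 / (2 * π)) ^ 2) / (4 * π) =
        Real.log (T / (2 * π)) ^ 2 / (4 * π) - Real.log (2516 / (2 * π)) ^ 2 / (4 * π) :=
      sub_div _ _ _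
    rw [hsd] at hup
    linarith

/-- With Lemma 8 discharged, **Johnston–Yang's Lemma 2.5 holds outright** (no named fact):
for `T ≥ 4πe`, `log²(T/2π)/(4π) − 0.9321 ≤ Σ_{0<γ≤T} m(ρ)/γ ≤ log²(T/2π)/(4π)`.
[cite: JohnstonYang2023, Lemma 2.5] [cite: BrentPlattTrudgian2022, Lemma 8]
[cite: SaouterTrudgianDemichel2015, Lemma 2.10] -/
theorem JohnstonYang2023_lemma25_holds {T : ℝ} (hT : 4 * π * Real.exp 1 ≤ T) :
    Real.log (T / (2 * π)) ^ 2 / (4 * π) - 0.9321 ≤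
        ∑ ρ ∈ zerosBetween 0 T, (riemannZetaZeroOrder ρ : ℝ) / ρ.im ∧
      ∑ ρ ∈ zerosBetween 0 T, (riemannZetaZeroOrder ρ : ℝ) / ρ.im ≤
        Real.log (T / (2 * π)) ^ 2 / (4 * π) :=
  JohnstonYang2023_lemma25 BrentPlattTrudgian2022_lemma8_holds hT

end Literature.NumberTheory.LFunctions

end
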